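import Summits.QuantumFields.BalabanUV.Beta.GAN24.HkKingOneStepSup
import Summits.QuantumFields.BalabanUV.Beta.GAN24.SoftColumnGradSupLetter
import Summits.QuantumFields.BalabanUV.Beta.GAN24.DressedOrderZeroChainRate
import Summits.QuantumFields.BalabanUV.T4Continuum.Support.BalabanDeltaKIdentification

/-!
# `BalabanUV.Beta.GAN24.SoftColumnConsistency` — binder row G-an2-4 ∕ (CONV-C), route R7: THE CONSISTENCY LETTER (R7-HCONS) OF THE PHYSICAL
# SOFT COLUMN IS A TREE THEOREM — `‖colBG q (k+1) X′ − colBG q k (parT X′)‖ ≤ δHc(d,a,L)·(L⁻¹)^k` for EVERY `a > 0`, every `L ≥ 1`, every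
# torus — and the V3-type dressed chains of `DressedOrderZeroChainRate` for h = the physical column are UNCONDITIONAL

NOT IN PRINT; OUR PROOF ATTEMPT (prover part P3 of row G-an2-4, fibre∕strip («Woodbury») lineage, gen 27; CRUX TEAM (2), ruling «YM
REDIRECT TOWARDS THE SUMMIT», 2026-08-21).  HONEST DEPENDENCY (cell records, verbatim): «continuum YM on T⁴ ⇐ BetaPertH ∧ nine spine
estimates (0/9 proved); BetaPertH ⇐ (D1) ∧ (D4) ∧ CAP+tail; G-an2-4 gates asym, D1 and NE2/3/4.»  HONEST FRAMING (cell contract, verbatim):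
«discharging `BetaPertH` makes Bałaban's UV stability UNCONDITIONAL — a real constructive-QFT result; it is NOT the continuum limit and NOT
the Clay problem.»  ABSOLUTE RULE: nothing printed is a hypothesis; no `def … : Prop`, no sorry; [folklore] assembly over TREE objects BY NAME.

## The item: INTERFACE REQUEST G-an2-4 (R7-HCONS) (this lineage, gen 26, INBOX 12:08Z l.8480 (5))

`∃ δ : ℕ → ℝ` summable, `‖colBG q (k+1) X′ − colBG q k (parT X′)‖ ≤ δ k` — the third background letter (`hc`, consistency at the block parent)
of the physical soft column `colBG q k = √(n_k^{d+1})·M̃_k e_q = a·n_k^{d+1}·𝒢_aQ_kᴴe_q` in the V3-type dressed chains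
(`DressedOrderZeroChainRate.norm_softDressedChain_succ_sub_le_rate`, gen 26 (F) p267981); the size letter is leaf-03's `norm_colBG_le` (R7-HCOL)
and the Lipschitz letter gen 26's `norm_colBG_sub_shiftBack_le` (R7-HLIP).  `beta/ROUTES-GAN24.md` v10 R7 (u) and PRICING-GAN24 v3.10 check #55:
«(R7-HCONS) ≡ (V-HALF) ≡ … the `H_k` constituent — the one open letter».

## The mechanism

(1.103) read as `𝒢_aQ* = H_k·(Q𝒢_aQ*)` (leaf-03's `calG_mulVec_src_eq`, b05's `HkOp_eq_Hk`, the NE2 lane's `covB_eq_QGQ`):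
**`colBG q k X = Σ_{q′} H_k(X, q′)·a·c_k(q′, q)`** (§1 `colBG_eq_sum`), `c_k = covBlev k = Q_k𝒢_aQ_k*` the unit covariance.  Hence
`colBG q (k+1) X′ − colBG q k (parT X′) = Σ_{q′} H_{k+1}(X′,q′)·a(c_{k+1} − c_k)(q′,q) + Σ_{q′} (H_{k+1}(X′,q′) − H_k(parT X′,q′))·a c_k(q′,q)`:
the first sum is `≤ KH d · a · ‖c_{k+1} − c_k‖_op ≤ KH d · a · CQB(d+1,a)·L^{−k}` (rows of `H_k` summable uniformly — leaf-03's `sum_norm_HkOp_le`;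
entries `≤` operator norm — `BalabanAveragedTowerUnit.norm_entry_le_opNorm`; the NE2-P1 tower law `BalabanAveragedCoerciveTower.opNorm_covBlev_succ_sub_le`);
the second is `≤ KH1s d · L^{−k} · 1` — THIS GEN's `HkKingOneStepSup.sum_norm_HkOp_par_sub_le` (the `H_k` one-step law against King's parent map, by
the NE2 lane's (1.63) strip rate) times `|a·c_k| ≤ 1` ((1.100), leaf-03's `norm_QGQ_apply_le`).
 * §1 `colBG_eq_sum`;  §2 `δHc`, **`norm_colBG_succ_sub_parT_le`**, `exists_hcons` (the letter in the socket's `∃`-free shape, summable rate);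
 * §3 **`norm_softColumnV3Chain_succ_sub_le`** ∕ **`norm_hardColumnV3Chain_succ_sub_le`**: gen 26 (F) instantiated with `W₁ = colBG q₁`,
   `W₂ = colBG q₂`, `α = KH d`, `β = KHg d`, `δ = δHc` — the V3-type dressed chains (soft legs `M̃`, hard legs `M̂ = n^{−d∕2}H_k`) with TWO
   PHYSICAL COLUMNS in the vertex slots obey the one-step law with NO letter left.

HONEST SCOPE.  [folklore] assembly BY NAME; `U = 1`; rate `θ = L⁻¹`; constants ours, crude (`δHc` depends on `d`, `a` through `KH·a·CQB(d+1,a)`);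
MODEL chains (no claim that they ARE Table-T rows — S1∕S7 are an2's∕p1's); NOT (CONV-C) as a whole, NEVER «G-an2-4 closed», NOT NE2, NOT D1,
NOT BetaPertH, NOT continuum, NOT Clay.  Locators (text only): [Balaban1984PropagatorsI] (1.63) p. 28, (1.71) p. 29, (1.100)–(1.103) p. 35;
[King1986] p. 664 (the pairing `x′ ↦ x`), Prop. 3.8 (3.71).  Provenance: prover-b2b-balaban-gan24-p3-g27-0 (unit `b2b-balaban-gan24-p3`, gen 27), 2026-08-21.
-/

noncomputable section

open scoped BigOperators ComplexConjugate Matrix Matrix.Norms.L2Operator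
open Finset

namespace Summit.QuantumFields.BalabanUV.Beta.GAN24.SoftColumnConsistency

open Literature.MathematicalPhysics.QuantumFieldTheory.Balaban1983to89
open Literature.MathematicalPhysics.QuantumFieldTheory.Balaban1983to89.B5Prop11Plancherel (Tor fine Cst)
open Literature.MathematicalPhysics.QuantumFieldTheory.Balaban1983to89.B5G183RateUnitTower (lev lev_neZero)
open Literature.MathematicalPhysics.QuantumFieldTheory.Balaban1983to89.B5Hk163Torus (HkOp)
open Literature.MathematicalPhysics.QuantumFieldTheory.Balaban1983to89.B5Hk163Form166 (HkOp_eq_Hk)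
open Literature.MathematicalPhysics.QuantumFieldTheory.Balaban1983to89.Beta.FluctuationProjection (Hk QGQ)
open Summit.QuantumFields.BalabanUV.T4Continuum
open Summit.QuantumFields.BalabanUV.T4Continuum.CovariantAveragingTower (Atow)
open Summit.QuantumFields.BalabanUV.T4Continuum.BalabanAveragedTowerUnit (idx lev_succ' one_le_lev' cast_lev' QBlev calGlev
  norm_entry_le_opNorm)
open Summit.QuantumFields.BalabanUV.T4Continuum.BalabanAveragedCoerciveTower (unitIdx covBlev opNorm_covBlev_succ_sub_le)
open Summit.QuantumFields.BalabanUV.T4Continuum.BalabanLineAverage (CQB CQB_nonneg)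
open Summit.QuantumFields.BalabanUV.T4Continuum.BalabanMinimizerLaw
open Summit.QuantumFields.BalabanUV.T4Continuum.BlockPairingGeometry (parT)
open Summit.QuantumFields.BalabanUV.T4Continuum.BalabanDeltaKIdentification (covB_eq_QGQ)
open Summit.QuantumFields.BalabanUV.Beta.GAN24.SoftColumnSupLetter (src KH KH_nonneg calG_mulVec_src_eq norm_QGQ_apply_le
  sum_norm_HkOp_le)
open Summit.QuantumFields.BalabanUV.Beta.GAN24.SoftColumnGradSupLetter (mulVec_src_eq KHg KHg_nonneg colBG norm_colBG_le
  norm_colBG_sub_shiftBack_le)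
open Summit.QuantumFields.BalabanUV.Beta.GAN24.DressedOrderZeroSlotLaw (shiftBack)
open Summit.QuantumFields.BalabanUV.Beta.GAN24.OrderZeroSlotLaw (CK)
open Summit.QuantumFields.BalabanUV.Beta.GAN24.DressedOrderZeroChain (DRop DRopsucc)
open Summit.QuantumFields.BalabanUV.Beta.GAN24.DressedOrderZeroChainRate (norm_softDressedChain_succ_sub_le_rate
  norm_hardDressedChain_succ_sub_le_rate)
open Summit.QuantumFields.BalabanUV.Beta.GAN24.HardColumnChains (Mhat CHH)
open Summit.QuantumFields.BalabanUV.T4Continuum.BalabanAveragedCoercive (gammaB gammaB_pos)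
open Summit.QuantumFields.BalabanUV.Beta.GAN24.HkKingOneStepSup (KH1s KH1s_nonneg sum_norm_HkOp_par_sub_le)

variable {d : ℕ} (L : ℕ) [NeZero L] (M : Fin (d + 1) → ℕ) [hM : ∀ μ, NeZero (M μ)] (a : ℝ) (ha : 0 < a)

/-! ## §1 The physical column is `H_k` applied to `a` times a column of the unit covariance -/

/-- `colBG q k X = a·(𝒢_k·src_q)(X)` — the value-level form of `SoftColumnSupLetter.sqrt_mul_norm_Mtil_apply`. [folklore] -/
theorem colBG_eq_mulVec_src (q : idx L M 0) (k : ℕ) (X : idx L M k) :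
    colBG L M a ha q k X = (a : ℂ) * (calGlev L M a ha k *ᵥ src L M k q) X := by
  have hs : (0 : ℝ) ≤ ((L : ℝ) ^ (d + 1)) ^ k := by positivity
  have hsq : ((((((L : ℝ) ^ (d + 1)) ^ k : ℝ)) : ℂ))
      = ((Real.sqrt (((L : ℝ) ^ (d + 1)) ^ k) : ℝ) : ℂ) * ((Real.sqrt (((L : ℝ) ^ (d + 1)) ^ k) : ℝ) : ℂ) := by
    rw [← Complex.ofReal_mul, Real.mul_self_sqrt hs]
  rw [colBG, mulVec_src_eq, Mtil, Matrix.smul_apply, smul_eq_mul, hsq]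
  push_cast
  ring

/-- the unit covariance on b05's carrier at level `k` IS `Q𝒢_aQ*` of the β cell: `QGQ n_k = covBlev k` (`covB_eq_QGQ`). [folklore] -/
theorem QGQ_eq_covBlev (k : ℕ) : QGQ (lev L k) (one_le_lev' L k) M a ha = covBlev L M a ha k := by
  rw [covBlev, covB_eq_QGQ]

/-- **`colBG q k X = Σ_{q′} H_k(X, q′)·(a·c_k(q′, qh))`**, `c_k = covBlev k`, `qh = unitIdx q` — (1.103) `𝒢_aQ* = H_k·(Q𝒢_aQ*)` at the column `q`.
[cite: Balaban1984PropagatorsI, (1.103) p.35] [folklore] -/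
theorem colBG_eq_sum (q : idx L M 0) (k : ℕ) (X : idx L M k) :
    colBG L M a ha q k X
      = ∑ q' : Tor M × Fin (d + 1), HkOp (lev L k) M X q' * ((a : ℂ) * covBlev L M a ha k q' (unitIdx L M q)) := by
  rw [colBG_eq_mulVec_src, calG_mulVec_src_eq, ← HkOp_eq_Hk (lev L k) (one_le_lev' L k) M a ha, QGQ_eq_covBlev,
    Matrix.mul_apply, Finset.mul_sum]
  exact Finset.sum_congr rfl fun q' _ => by ring

/-! ## §2 (R7-HCONS): the consistency letter of the physical column at the block parent -/

/-- **the rate of the consistency letter**: `δHc d a L k := (KH d · a · CQB(d+1, a) + KH1s d)·(L⁻¹)^k` — summable geometric for `L ≥ 2`.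
OURS, crude. [folklore] -/
def δHc (d : ℕ) (a : ℝ) (L : ℕ) (k : ℕ) : ℝ := (KH d * a * CQB (d + 1) a + KH1s d) * ((L : ℝ)⁻¹) ^ k

omit [NeZero L] in
/-- `0 ≤ δHc`. [folklore] -/
theorem δHc_nonneg (h0 : 0 ≤ a) (k : ℕ) : 0 ≤ δHc d a L k := by
  have h1 := KH_nonneg d
  have h2 := CQB_nonneg (d + 1) a
  have h3 := KH1s_nonneg d
  unfold δHc; positivity

/-- **(R7-HCONS) — THE CONSISTENCY LETTER OF THE PHYSICAL SOFT COLUMN AT THE BLOCK PARENT IS A TREE THEOREM**: for every `a > 0`, `L ≥ 1`,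
torus `M`, coarse bond `q`, level `k` and fine bond `X′` of level `k+1`,
`‖colBG q (k+1) X′ − colBG q k (parT X′)‖ ≤ δHc(d,a,L,k) = (KH d·a·CQB(d+1,a) + KH1s d)·L^{−k}`.
MECHANISM: §1 + the split `H′·a(c′ − c) + (H′ − H∘par)·(a c)`; first term by `sum_norm_HkOp_le` × `norm_entry_le_opNorm` ×
`opNorm_covBlev_succ_sub_le`, second by `HkKingOneStepSup.sum_norm_HkOp_par_sub_le` × `norm_QGQ_apply_le`.
[cite: King1986, Prop. 3.8 (3.71) p.664 (scalar template); Balaban1984PropagatorsI, (1.63) p.28, (1.100)–(1.103) p.35] [folklore] -/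
theorem norm_colBG_succ_sub_parT_le (q : idx L M 0) (k : ℕ) (X' : idx L M (k + 1)) :
    ‖colBG L M a ha q (k + 1) X' - colBG L M a ha q k (parT (lev L k) L M X')‖ ≤ δHc d a L k := by
  have hL0 : (0 : ℝ) < L := by exact_mod_cast Nat.pos_of_ne_zero (NeZero.ne L)
  set qh := unitIdx L M q with hq
  set H' : Tor M × Fin (d + 1) → ℂ := fun q' => HkOp (lev L (k + 1)) M X' q' with hH'
  set H : Tor M × Fin (d + 1) → ℂ := fun q' => HkOp (lev L k) M (parT (lev L k) L M X') q' with hH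
  set c' : Tor M × Fin (d + 1) → ℂ := fun q' => (a : ℂ) * covBlev L M a ha (k + 1) q' qh with hc'
  set c : Tor M × Fin (d + 1) → ℂ := fun q' => (a : ℂ) * covBlev L M a ha k q' qh with hc
  have e : colBG L M a ha q (k + 1) X' - colBG L M a ha q k (parT (lev L k) L M X')
      = ∑ q', H' q' * (c' q' - c q') + ∑ q', (H' q' - H q') * c q' := by
    rw [colBG_eq_sum, colBG_eq_sum, ← Finset.sum_sub_distrib, ← Finset.sum_add_distrib]
    exact Finset.sum_congr rfl fun q' _ => by simp only [hH', hH, hc', hc]; ring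
  rw [e]
  -- first sum: rows of `H_{k+1}` × the operator-norm tower law of the unit covariance
  have hcc : ∀ q', ‖c' q' - c q'‖ ≤ a * (CQB (d + 1) a * ((L : ℝ)⁻¹) ^ k) := fun q' => by
    simp only [hc', hc]
    rw [← mul_sub, norm_mul, Complex.norm_real, Real.norm_of_nonneg ha.le, ← Matrix.sub_apply]
    exact mul_le_mul_of_nonneg_left ((norm_entry_le_opNorm _ q' qh).trans (opNorm_covBlev_succ_sub_le L M a ha k)) ha.le
  have h1 : ‖∑ q', H' q' * (c' q' - c q')‖ ≤ KH d * (a * (CQB (d + 1) a * ((L : ℝ)⁻¹) ^ k)) := by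
    have h0 : 0 ≤ a * (CQB (d + 1) a * ((L : ℝ)⁻¹) ^ k) := by have := CQB_nonneg (d + 1) a; positivity
    calc ‖∑ q', H' q' * (c' q' - c q')‖ ≤ ∑ q', ‖H' q' * (c' q' - c q')‖ := norm_sum_le _ _
      _ ≤ ∑ q', ‖H' q'‖ * (a * (CQB (d + 1) a * ((L : ℝ)⁻¹) ^ k)) :=
          Finset.sum_le_sum fun q' _ => by rw [norm_mul]; exact mul_le_mul_of_nonneg_left (hcc q') (norm_nonneg _)
      _ = (∑ q', ‖H' q'‖) * (a * (CQB (d + 1) a * ((L : ℝ)⁻¹) ^ k)) := by rw [Finset.sum_mul]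
      _ ≤ KH d * (a * (CQB (d + 1) a * ((L : ℝ)⁻¹) ^ k)) :=
          mul_le_mul_of_nonneg_right (sum_norm_HkOp_le M (lev L (k + 1)) X') h0
  -- second sum: THIS GEN's `H_k` one-step law against King's parent × `|a·c_k| ≤ 1`
  have hc1 : ∀ q', ‖c q'‖ ≤ 1 := fun q' => by
    simp only [hc]
    rw [norm_mul, Complex.norm_real, Real.norm_of_nonneg ha.le, ← QGQ_eq_covBlev]
    calc a * ‖QGQ (lev L k) (one_le_lev' L k) M a ha q' qh‖ ≤ a * a⁻¹ :=
          mul_le_mul_of_nonneg_left (norm_QGQ_apply_le M a ha (lev L k) (one_le_lev' L k) q' qh) ha.le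
      _ = 1 := mul_inv_cancel₀ ha.ne'
  have h2 : ‖∑ q', (H' q' - H q') * c q'‖ ≤ KH1s d * ((L : ℝ)⁻¹) ^ k := by
    have hrow : ∑ q', ‖H' q' - H q'‖ ≤ KH1s d / (lev L k : ℕ) := by
      have h := sum_norm_HkOp_par_sub_le (N := lev L k) (R := L) M X'
      simpa [hH', hH, parT, lev_succ'] using h
    calc ‖∑ q', (H' q' - H q') * c q'‖ ≤ ∑ q', ‖(H' q' - H q') * c q'‖ := norm_sum_le _ _
      _ ≤ ∑ q', ‖H' q' - H q'‖ * 1 :=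
          Finset.sum_le_sum fun q' _ => by rw [norm_mul]; exact mul_le_mul_of_nonneg_left (hc1 q') (norm_nonneg _)
      _ = ∑ q', ‖H' q' - H q'‖ := by simp
      _ ≤ KH1s d / (lev L k : ℕ) := hrow
      _ = KH1s d * ((L : ℝ)⁻¹) ^ k := by rw [cast_lev', div_eq_mul_inv, inv_pow]
  calc _ ≤ ‖∑ q', H' q' * (c' q' - c q')‖ + ‖∑ q', (H' q' - H q') * c q'‖ := norm_add_le _ _
    _ ≤ KH d * (a * (CQB (d + 1) a * ((L : ℝ)⁻¹) ^ k)) + KH1s d * ((L : ℝ)⁻¹) ^ k := add_le_add h1 h2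
    _ = δHc d a L k := by rw [δHc]; ring

/-- **(R7-HCONS) in the `∃`-shape of the INTERFACE REQUEST** (INBOX 2026-08-21T12:08Z l.8480 (5)): a nonnegative, geometrically decaying
sequence `δ` with `‖colBG q (k+1) X′ − colBG q k (parT X′)‖ ≤ δ k` for all `q, k, X′`. NO hypothesis. [folklore] -/
theorem exists_hcons :
    ∃ δ : ℕ → ℝ, (∀ k, 0 ≤ δ k) ∧ (∃ C : ℝ, 0 ≤ C ∧ ∀ k, δ k ≤ C * ((L : ℝ)⁻¹) ^ k) ∧
      ∀ (q : idx L M 0) (k : ℕ) (X' : idx L M (k + 1)),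
        ‖colBG L M a ha q (k + 1) X' - colBG L M a ha q k (parT (lev L k) L M X')‖ ≤ δ k := by
  refine ⟨δHc d a L, δHc_nonneg (d := d) L a ha.le, ⟨KH d * a * CQB (d + 1) a + KH1s d, ?_, fun k => le_rfl⟩,
    norm_colBG_succ_sub_parT_le L M a ha⟩
  have h1 := KH_nonneg d
  have h2 := CQB_nonneg (d + 1) a
  have h3 := KH1s_nonneg d
  positivity

/-! ## §3 The V3-type dressed soft-leg chain with PHYSICAL COLUMNS in both vertex slots: no letter left -/

/-- **THE DRESSED SOFT-LEG V3-TYPE CHAIN OF `DressedOrderZeroChainRate` WITH THE PHYSICAL COLUMNS `colBG q₁`, `colBG q₂` IN THE TWO VERTEX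
SLOTS OBEYS THE ONE-STEP LAW UNCONDITIONALLY**: entrywise
`‖M̃_{k+1}ᴴ·DRopsucc(colBG q₁, colBG q₂)·M̃_{k+1} − M̃_kᴴ·DRop(colBG q₁, colBG q₂)·M̃_k‖(p,r)
 ≤ 2(aCst)(KH+KHg)²Cst·(aCQH)·L^{−k} + (aCst)²·(KH²·CK·L^{−k} + 2·KH·L²·Cst·δHc(k))`
— gen 26 (F) `norm_softDressedChain_succ_sub_le_rate` with its three background letters DISCHARGED: size (leaf-03 `norm_colBG_le`), Lipschitz
(gen 26 `norm_colBG_sub_shiftBack_le`), consistency (§2 `norm_colBG_succ_sub_parT_le`). [folklore] -/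
theorem norm_softColumnV3Chain_succ_sub_le (q₁ q₂ : idx L M 0) (k : ℕ) (μ μ' : Fin (d + 1)) (p r : idx L M 0) :
    ‖((atSucc' L M k (Mtil L M a ha (k + 1)))ᴴ * DRopsucc L M a ha (colBG L M a ha q₁) (colBG L M a ha q₂) k μ μ'
          * atSucc' L M k (Mtil L M a ha (k + 1))
        - (Mtil L M a ha k)ᴴ * DRop L M a ha (colBG L M a ha q₁) (colBG L M a ha q₂) k μ μ' * Mtil L M a ha k) p r‖
      ≤ 2 * ((a * Cst (d + 1) a) * ((KH d + KHg d) * ((KH d + KHg d) * Cst (d + 1) a)) * (a * CQH (d + 1) a * ((L : ℝ)⁻¹) ^ k))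
          + (a * Cst (d + 1) a) * (KH d * KH d * CK (d + 1) L a * ((L : ℝ)⁻¹) ^ k
              + 2 * KH d * ((L : ℝ) * L) * Cst (d + 1) a * δHc d a L k) * (a * Cst (d + 1) a) :=
  norm_softDressedChain_succ_sub_le_rate L M a ha (by omega) (colBG L M a ha q₁) (colBG L M a ha q₂) (KH_nonneg d) (KHg_nonneg d)
    (δHc_nonneg (d := d) L a ha.le) (fun k i => norm_colBG_le L M a ha q₁ k i) (fun k i => norm_colBG_le L M a ha q₂ k i)
    (fun k μ i => norm_colBG_sub_shiftBack_le L M a ha q₁ k μ i) (fun k μ i => norm_colBG_sub_shiftBack_le L M a ha q₂ k μ i)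
    (fun k i => norm_colBG_succ_sub_parT_le L M a ha q₁ k i) (fun k i => norm_colBG_succ_sub_parT_le L M a ha q₂ k i) k μ μ' p r

/-- **THE SAME FOR THE HARD (CONSTRAINED) LEGS `M̂ = n^{−d∕2}H_k`** (`HardColumnChains.Mhat`): gen 26 (F) `norm_hardDressedChain_succ_sub_le_rate` with
the physical columns `colBG q₁`, `colBG q₂` in the vertex slots, all three letters discharged — NO hypothesis. [folklore] -/
theorem norm_hardColumnV3Chain_succ_sub_le (q₁ q₂ : idx L M 0) (k : ℕ) (μ μ' : Fin (d + 1)) (p r : idx L M 0) :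
    ‖((atSucc' L M k (Mhat L M a ha (k + 1)))ᴴ * DRopsucc L M a ha (colBG L M a ha q₁) (colBG L M a ha q₂) k μ μ'
          * atSucc' L M k (Mhat L M a ha (k + 1))
        - (Mhat L M a ha k)ᴴ * DRop L M a ha (colBG L M a ha q₁) (colBG L M a ha q₂) k μ μ' * Mhat L M a ha k) p r‖
      ≤ 2 * ((Cst (d + 1) a * (gammaB (d + 1) a)⁻¹) * ((KH d + KHg d) * ((KH d + KHg d) * Cst (d + 1) a))
            * (CHH (d + 1) a * ((L : ℝ)⁻¹) ^ k))
          + (Cst (d + 1) a * (gammaB (d + 1) a)⁻¹) * (KH d * KH d * CK (d + 1) L a * ((L : ℝ)⁻¹) ^ k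
              + 2 * KH d * ((L : ℝ) * L) * Cst (d + 1) a * δHc d a L k) * (Cst (d + 1) a * (gammaB (d + 1) a)⁻¹) :=
  norm_hardDressedChain_succ_sub_le_rate L M a ha (by omega) (colBG L M a ha q₁) (colBG L M a ha q₂) (KH_nonneg d) (KHg_nonneg d)
    (δHc_nonneg (d := d) L a ha.le) (fun k i => norm_colBG_le L M a ha q₁ k i) (fun k i => norm_colBG_le L M a ha q₂ k i)
    (fun k μ i => norm_colBG_sub_shiftBack_le L M a ha q₁ k μ i) (fun k μ i => norm_colBG_sub_shiftBack_le L M a ha q₂ k μ i)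
    (fun k i => norm_colBG_succ_sub_parT_le L M a ha q₁ k i) (fun k i => norm_colBG_succ_sub_parT_le L M a ha q₂ k i) k μ μ' p r

end Summit.QuantumFields.BalabanUV.Beta.GAN24.SoftColumnConsistency

end
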